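import Literature.AlgebraicGeometry.Motives.AbelianVarietyBlochGrVanishing
import Literature.AlgebraicGeometry.Motives.HypersurfaceSectionDegree
import Literature.AlgebraicGeometry.Motives.AsymptoticRiemannRochProofs
import Literature.AlgebraicGeometry.Motives.ResidueDegreeClosure
import Literature.AlgebraicGeometry.Motives.GeneratingSectionsOfCocycle
import HarnessLib

/-!
# The degree of a projective variety is the `h⁰`-asymptotic degree of its hyperplane class
# (Fulton, Example 2.5.2 ⟷ Görtz–Wedhorn II, Def. 23.80 / Prop. 23.83)

For an integral closed subvariety `j : X ↪ ℙᴺ_K` of dimension `n + 1` over an algebraically closed field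
and a hyperplane `V₊(ℓ₀) ⊅ X` with hyperplane-section divisor `H_X = j^*V₊(ℓ₀)`
(`(formDivisor ℓ₀ …).pullbackAvoiding j.left _`, the divisor of the cell's (C1)/(C2)/(C3) files), the tree
has TWO integers attached to `𝒪_X(1)`:

* Fulton's **degree** `∫_X c₁(𝒪_X(1))^{n+1} ∩ [X]` ([Fulton1998] §2.5, Example 2.5.2), in the tree's Chow
  currency `ChowGroup.degree X (hyperplaneSectionOn j … 0 (hyperplaneSectionOnIter j … (0 + 1) n [X]))`
  (`Motives/ProjectiveSpaceHyperplaneSection`, `Motives/HypersurfaceLinearSections`, `Motives/ChowDegree`);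
* the **`h⁰`-asymptotic degree** `asympDegree K H_X (n + 1)`, the integer `δ` with
  `h⁰(k H_X) = δ k^{n+1}/(n+1)! + O(k^n)` ([GortzWedhorn2023] Def. 23.80 by Prop. 23.83; the tree's
  `CartierDivisor.HasAsympDegree` / `asympDegree` of `Motives/AbelianVarietyDegree`, which exists for the
  ample `H_X` by the PROVED asymptotic Riemann–Roch theorem `CartierDivisor.asymptoticRiemannRoch_of_isAmple_holds`).

This file proves that they are EQUAL (`ProjSpace.degree_hyperplaneSection_iter_fundamental_eq_asympDegree`),
in the binder form `… = δ` whenever `H_X.HasAsympDegree K (n + 1) δ`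
(`ProjSpace.degree_hyperplaneSection_iter_fundamental_eq_of_hasAsympDegree`) and in the consumer form
`… = (n+1)! · a` whenever `H_X ∼ Θ` with an exact count `h⁰(kΘ) = a k^{n+1}` (`k ≥ 1`)
(`ProjSpace.degree_hyperplaneSection_iter_fundamental_eq_of_forall_h0_eq`) — the latter is how the
count enters for an abelian variety of dimension `g` embedded by `L^Δ(λ)^{⊗3}` of type `δ`
(`h⁰ = (6k)^g ∏ δᵢ`, [MumfordFogartyKirwan1994] Prop. 6.13; degree `r = (L'^g) = g! · 6^g · ∏ δᵢ`, loc. cit.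
proof of Prop. 7.7, p. 138).  No Hilbert polynomials and no local algebra (Fulton, Lemma A.2.7) are used.

## Proof (projection formula along a projective Noether normalisation)

`H_X` is ample (`ProjSpace.isAmple_pullbackAvoiding_formDivisor`), so [GortzWedhorn2020] Thm. 13.89 in the
tree's form `CartierDivisor.IsAmple.exists_finite_surjective_linEquiv` (`Motives/ProjectiveNoetherNormalization`)
gives a finite surjective `K`-morphism `ψ : X → ℙ^{n+1}` and `M > 0` with `ψ^*H ∼ M • H_X`; by
`CartierDivisor.hasAsympDegree_pullback_hyperplane` (`Motives/AsymptoticRiemannRochProofs`),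
`h⁰(k ψ^*H) = r k^{n+1}/(n+1)! + O(k^n)` with `r = [K(X) : K(ℙ^{n+1})]`
(`ProjSpace.exists_finite_linEquiv_nsmul_hasAsympDegree`).  Then:

1. CHOW SIDE (`ProjSpace.natCast_pow_mul_degree_hyperplaneSection_iter_eq_finrank`):
   `M^{n+1} · deg (c₁(𝒪_X(1))^{n+1} ∩ [X]) = r`.  Indeed `M • (c₁(𝒪_X(1)) ∩ [c]) = [ψ^*H · c]`
   ([Fulton1998] Prop. 2.3 (b): `ProjSpace.nsmul_hyperplaneSectionOn_mk`, from the tree's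
   `LinEquiv.interCycle_sub_interCycle_mem` and `CartierDivisor.interCycle_nsmul_sub_mem`), the projection
   formula `ψ_*((ψ^*H) · c) = H · ψ_* c` ([Fulton1998] Prop. 2.3 (c): the tree's
   `CartierDivisor.map_interCycle_pullback_sub_mem`; here `ProjSpace.pushforward_nsmul_hyperplaneSectionOn`,
   iterated in `ProjSpace.pushforward_pow_nsmul_hyperplaneSectionOnIter`), `ψ_*[X] = r • [ℙ^{n+1}]`
   ([Fulton1998] §1.4: `ProjSpace.pushforward_ofPoint_genericPoint_eq_finrank_smul`, the residue degree at
   the generic point being `[K(X) : K(ℙ^{n+1})]`, `ClosedSubvariety.residueDegree_eq_finrank_of_fac`),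
   `deg (c₁(𝒪(1))^{n+1} ∩ [ℙ^{n+1}]) = 1` ([Fulton1998] Example 2.5.1:
   `ProjSpace.degree_hyperplaneSection_hyperplaneSectionIter_ofPoint_genericPoint`), and the degree is
   invariant under proper push-forward (`ChowGroup.degree_pushforward`).
2. `h⁰` SIDE (`ProjSpace.eq_mul_pow_of_hasAsympDegree_of_linEquiv_nsmul`): `r = δ M^{n+1}`, comparing the
   expansions of `h⁰(k ψ^*H) = h⁰((Mk) H_X)` (uniqueness of the leading coefficient,
   `eq_of_sub_mul_pow_div_isBigO`, as in [GortzWedhorn2023] proof of Prop. 27.186).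
3. Cancel `M^{n+1} ≠ 0`.

THEOREMS ONLY (no definition, no named fact, no instance, no notation).  Cell hodgecm-mathlib (D-0151),
F-9 (9a) step (C4) «`r` explicit» = the `hdegA` bridge (director g12 s245/s249; census
`B-provers/B-p04/g21/CENSUS-F9-C4-CycleDegreeBound.B-p04g21.md`, road (R1′)); consumer: the (9a) count
`CartierDivisor.ncard_preimage_inter_hyperplaneSection_le` (`Motives/TorsionPointsOnHyperplaneSection`), whose
bound is `m^n ·` the degree identified here.  HC_CM is proved only modulo the 7 printed citations until rung 0
closes; nothing in this file bears on a summit statement.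

## References
* [Fulton1998] W. Fulton, *Intersection Theory*, 2nd ed., Springer (1998): §1.4 (p. 11), Def. 1.4 (p. 13),
  Example 1.9.3 (p. 23), Prop. 2.3 (b), (c) (p. 34), §2.5 with Examples 2.5.1–2.5.2 (p. 41).
* [GortzWedhorn2023] U. Görtz, T. Wedhorn, *Algebraic Geometry II: Cohomology of Schemes* (2023): Def. 23.76,
  Def. 23.80, Rem. 23.82, Prop. 23.83; proof of Prop. 27.186.
* [GortzWedhorn2020] U. Görtz, T. Wedhorn, *Algebraic Geometry I*, 2nd ed. (2020): Prop. 13.66 (2) (p. 402),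
  Thm. 13.89 (p. 412).
* [MumfordFogartyKirwan1994] D. Mumford, J. Fogarty, F. Kirwan, *Geometric Invariant Theory*, 3rd ed. (1994):
  Ch. 6 §2 Prop. 6.13 (p. 123); Ch. 7 §3 Prop. 7.7 and its proof (p. 138: `r = degree`, via [Lang AV p. 92 (iv)]).
-/

noncomputable section
universe u
open CategoryTheory AlgebraicGeometry Order Asymptotics Filter
open Literature.AlgebraicGeometry.Motives.Segre Literature.AlgebraicGeometry.Motives.RatFn

namespace Literature.AlgebraicGeometry.Motives

namespace ProjSpace

open CartierDivisor

variable {K : Type u} [Field K] [Infinite K] {N : ℕ} {X : SchemeOver K} [IsIntegral X.left]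
  [IsProper X.hom] (j : X ⟶ projectiveSpace N K) [IsClosedImmersion j.left]
  {ℓ₀ : MvPolynomial (Fin (N + 1)) K} (hℓ₀ : ℓ₀ ∈ grading (Fin (N + 1)) K 1) (hℓ₀0 : ℓ₀ ≠ 0)
  (hX₀ : (formDivisor ℓ₀ hℓ₀ hℓ₀0).Avoids (j.left.base (genericPoint ↥X.left)))

/-! ### §1 `M • (c₁(𝒪_X(1)) ∩ -)` is `ψ^*H · -` when `ψ^*H ∼ M • H_X` -/

/-- **`M • (c₁(𝒪_X(1)) ∩ [c]) = [ψ^*H · c]`** in `CH_n(X)` when `ψ^*H ∼ M • H_X` for a dominant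
`ψ : X → ℙ^d` (Fulton Def. 2.3 and Prop. 2.3 (b): `D · α` depends only on the linear equivalence
class of `D` and is additive in `D`). [cite: Fulton1998, Prop. 2.3 (b) (p. 34)] -/
theorem nsmul_hyperplaneSectionOn_mk {d : ℕ} (ψ : X ⟶ projectiveSpace d K) [IsDominant ψ.left]
    {M : ℕ}
    (hlin : (CartierDivisor.pullback (X := (projectiveSpace d K).left) (hyperplane d K) ψ.left).LinEquiv
      (M • (formDivisor ℓ₀ hℓ₀ hℓ₀0).pullbackAvoiding j.left hX₀))
    (n : ℕ) (c : ↥(cyclesOfDim X.left (n + 1))) :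
    M • hyperplaneSectionOn j hℓ₀ hℓ₀0 hX₀ n (ChowGroup.mk X.left (n + 1) c) =
      ChowGroup.mk X.left n
        ⟨(CartierDivisor.pullback (X := (projectiveSpace d K).left) (hyperplane d K) ψ.left).interCycle c,
          interCycle_mem_cyclesOfDim _ c.2⟩ := by
  haveI : CompactSpace ↥X.left := j.left.isClosedEmbedding.compactSpace
  set H := (formDivisor ℓ₀ hℓ₀ hℓ₀0).pullbackAvoiding j.left hX₀ with hH
  set E := CartierDivisor.pullback (X := (projectiveSpace d K).left) (hyperplane d K) ψ.left with hE
  have hfin := finite_support_of_compactSpace (c : AlgebraicCycle X.left ℤ)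
  rw [hyperplaneSectionOn_mk, ← map_nsmul, ChowGroup.mk_eq_mk_iff]
  change M • H.interCycle c - E.interCycle c ∈ ratTrivial X.left n
  have h2 := CartierDivisor.interCycle_nsmul_sub_mem H c.2 hfin M
  have h3 := ratTrivialOn_le_ratTrivial (hlin.interCycle_sub_interCycle_mem c.2 hfin)
  have key : M • H.interCycle c - E.interCycle c =
      -((M • H).interCycle c - M • H.interCycle c) + -(E.interCycle c - (M • H).interCycle c) := by
    abel
  rw [key]
  exact add_mem (neg_mem h2) (neg_mem h3)

/-- **Projection formula along `ψ`** (Fulton Prop. 2.3 (c), the tree's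
`CartierDivisor.map_interCycle_pullback_sub_mem`): `ψ_*(M • c₁(𝒪_X(1)) ∩ z) = c₁(𝒪(1)) ∩ ψ_* z` in
`CH_n(ℙ^d)`. [cite: Fulton1998, Prop. 2.3 (c) (p. 34)] -/
theorem pushforward_nsmul_hyperplaneSectionOn {d : ℕ} (ψ : X ⟶ projectiveSpace d K)
    [IsDominant ψ.left] [IsFinite ψ.left] {M : ℕ}
    (hlin : (CartierDivisor.pullback (X := (projectiveSpace d K).left) (hyperplane d K) ψ.left).LinEquiv
      (M • (formDivisor ℓ₀ hℓ₀ hℓ₀0).pullbackAvoiding j.left hX₀))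
    (n : ℕ) (z : ChowGroup X.left (n + 1)) :
    ChowGroup.pushforward n (map_mem_ratTrivial_holds n) ψ (M • hyperplaneSectionOn j hℓ₀ hℓ₀0 hX₀ n z) =
      hyperplaneSection d K n (ChowGroup.pushforward (n + 1) (map_mem_ratTrivial_holds (n + 1)) ψ z) := by
  haveI : CompactSpace ↥X.left := j.left.isClosedEmbedding.compactSpace
  induction z using ChowGroup.induction_on with
  | h c =>
    have hfin := finite_support_of_compactSpace (c : AlgebraicCycle X.left ℤ)
    rw [nsmul_hyperplaneSectionOn_mk j hℓ₀ hℓ₀0 hX₀ ψ hlin, ChowGroup.pushforward_mk,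
      ChowGroup.pushforward_mk, hyperplaneSection_mk, ChowGroup.mk_eq_mk_iff]
    exact ratTrivialOn_le_ratTrivial
      (CartierDivisor.map_interCycle_pullback_sub_mem ψ (hyperplane d K) c.2 hfin)

/-- Iterating the projection formula: **`ψ_*(M^c • (c₁(𝒪_X(1))^c ∩ x)) = c₁(𝒪(1))^c ∩ ψ_* x`** in
`CH_m(ℙ^d)`. [cite: Fulton1998, Prop. 2.3 (c) (p. 34)] -/
theorem pushforward_pow_nsmul_hyperplaneSectionOnIter {d : ℕ} (ψ : X ⟶ projectiveSpace d K)
    [IsDominant ψ.left] [IsFinite ψ.left] {M : ℕ}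
    (hlin : (CartierDivisor.pullback (X := (projectiveSpace d K).left) (hyperplane d K) ψ.left).LinEquiv
      (M • (formDivisor ℓ₀ hℓ₀ hℓ₀0).pullbackAvoiding j.left hX₀))
    (m : ℕ) :
    ∀ (c : ℕ) (x : ChowGroup X.left (m + c)),
      ChowGroup.pushforward m (map_mem_ratTrivial_holds m) ψ
          (M ^ c • hyperplaneSectionOnIter j hℓ₀ hℓ₀0 hX₀ m c x) =
        hyperplaneSectionIter d K m c (ChowGroup.pushforward (m + c) (map_mem_ratTrivial_holds (m + c)) ψ x)
  | 0, x => by simp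
  | c + 1, x => by
    rw [hyperplaneSectionOnIter_succ, hyperplaneSectionIter_succ, pow_succ, ← _root_.smul_smul,
      ← map_nsmul, pushforward_pow_nsmul_hyperplaneSectionOnIter ψ hlin m c,
      pushforward_nsmul_hyperplaneSectionOn j hℓ₀ hℓ₀0 hX₀ ψ hlin (m + c) x]
    rfl

/-! ### §2 `ψ_*[X] = [K(X) : K(ℙ^d)] • [ℙ^d]` -/

omit [Infinite K] [IsProper X.hom] in
/-- **The residue degree of a finite dominant `ψ : X → ℙ^d` at the generic point of `X` is the degree
`[K(X) : K(ℙ^d)]` of the function field extension** (Fulton §1.4: `deg(V/W) = [R(V) : R(W)]` with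
`V = X`, `W = ψ(X) = ℙ^d`; the tree's `ClosedSubvariety.residueDegree_eq_finrank_of_fac` for the
closed subvarieties `X ⊆ X`, `ℙ^d ⊆ ℙ^d`). [cite: Fulton1998, §1.4 (p. 11)] -/
theorem residueDegree_genericPoint_eq_finrank {d : ℕ} (ψ : X ⟶ projectiveSpace d K)
    [IsDominant ψ.left] [IsFinite ψ.left] :
    ψ.left.residueDegree (genericPoint ↥X.left) =
      Module.finrank (projectiveSpace d K).left.functionField (FunctionFieldOver ψ.left) :=
  ClosedSubvariety.residueDegree_eq_finrank_of_fac ψ.left (ClosedSubvariety.mk X.left (𝟙 _))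
    (ClosedSubvariety.mk (projectiveSpace d K).left (𝟙 _)) ψ.left (by simp)

omit [Infinite K] [IsProper X.hom] in
/-- **`ψ_*[X] = [K(X) : K(ℙ^d)] • [ℙ^d]` as cycles** for a finite dominant `ψ : X → ℙ^d`
(Fulton §1.4: `f_*[V] = deg(V/f(V)) [f(V)]`; the generic point of `X` maps to the generic point of
`ℙ^d`; for finite `ψ` the dimension weights agree). [cite: Fulton1998, §1.4 (p. 11)] -/
theorem map_primeCycle_genericPoint_eq_finrank_smul {d : ℕ} (ψ : X ⟶ projectiveSpace d K)
    [IsDominant ψ.left] [IsFinite ψ.left] :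
    AlgebraicCycle.map ψ.left height height (primeCycle (genericPoint ↥X.left)) =
      Module.finrank (projectiveSpace d K).left.functionField (FunctionFieldOver ψ.left) •
        primeCycle (genericPoint ↥(projectiveSpace d K).left) := by
  rw [algebraicCycleMap_primeCycle_eq_nsmul,
    mapCoeff_height_eq_residueDegree ψ.left (projectiveSpace d K).hom,
    residueDegree_genericPoint_eq_finrank ψ]
  congr 2
  exact genericPoint_eq_of_isDominant ψ.left

omit [Infinite K] in
/-- **`ψ_*[X] = [K(X) : K(ℙ^d)] • [ℙ^d]` in `CH_e(ℙ^d)`** for a finite dominant `ψ : X → ℙ^d`,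
`e = dim X = dim ℙ^d`. [cite: Fulton1998, §1.4 (p. 11) and Example 1.9.3 (p. 23)] -/
theorem pushforward_ofPoint_genericPoint_eq_finrank_smul {d e : ℕ} (ψ : X ⟶ projectiveSpace d K)
    [IsDominant ψ.left] [IsFinite ψ.left] (hdim : height (genericPoint ↥X.left) = (e : ℕ∞))
    (hdimP : height (genericPoint ↥(projectiveSpace d K).left) = (e : ℕ∞)) :
    ChowGroup.pushforward e (map_mem_ratTrivial_holds e) ψ
        (ChowGroup.ofPoint (genericPoint ↥X.left) hdim) =
      Module.finrank (projectiveSpace d K).left.functionField (FunctionFieldOver ψ.left) •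
        ChowGroup.ofPoint (genericPoint ↥(projectiveSpace d K).left) hdimP := by
  rw [ChowGroup.ofPoint, ChowGroup.pushforward_mk, ChowGroup.ofPoint, ← map_nsmul]
  congr 1
  exact Subtype.ext (map_primeCycle_genericPoint_eq_finrank_smul ψ)

/-! ### §3 `deg (c₁(𝒪(1)) ∩ (c₁(𝒪(1))^n ∩ [ℙ^{n+1}])) = 1` -/

/-- **`∫_{ℙ^{n+1}} c₁(𝒪(1)) ∩ (c₁(𝒪(1))^n ∩ [ℙ^{n+1}]) = 1`** (`K` algebraically closed): the generic point
of `ℙ^{n+1}` is the `(n+1)`-plane point `λ_{n+1}` of the top coordinate cell, and the iterated hyperplane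
section of the class of an `(n+1)`-plane is the class of a `K`-rational point (Fulton, Example 2.5.1:
linear subspaces have degree one). [cite: Fulton1998, Example 2.5.1 (p. 41)] -/
theorem degree_hyperplaneSection_hyperplaneSectionIter_ofPoint_genericPoint [IsAlgClosed K] (n : ℕ)
    (hgen : height (genericPoint ↥(projectiveSpace (n + 1) K).left) = ((0 + 1 + n : ℕ) : ℕ∞)) :
    ChowGroup.degree (projectiveSpace (n + 1) K)
      (hyperplaneSection (n + 1) K 0
        (hyperplaneSectionIter (n + 1) K (0 + 1) n
          (ChowGroup.ofPoint (genericPoint ↥(projectiveSpace (n + 1) K).left) hgen))) = 1 := by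
  have e : 0 + 1 + n = n + 1 := by omega
  have hmem : genericPoint ↥(projectiveSpace (n + 1) K).left ∈
      ProjectiveSpaceCells.coordSubspace K (n + 1) (0 + 1 + n) := by
    rw [e, ProjectiveSpaceCells.coordSubspace_self]
    exact Set.mem_univ _
  have hpt : genericPoint ↥(projectiveSpace (n + 1) K).left =
      ProjectiveSpaceCells.coordGenericPoint K (n := n + 1) (0 + 1 + n) :=
    ProjectiveSpaceCells.eq_coordGenericPoint_of_height_eq K (by omega) hmem hgen
  have hw : IsLinearSubspacePoint (0 + 1 + n) (n + 1) (𝟙 (projectiveSpace (n + 1) K))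
      (genericPoint ↥(projectiveSpace (n + 1) K).left) := by
    rw [hpt]
    exact ProjectiveSpaceCells.isLinearSubspacePoint_coordGenericPoint K (by omega)
  obtain ⟨w', hw', h'⟩ := exists_hyperplaneSectionIter_ofPoint_eq (N := n + 1) (K := K) (0 + 1) n hw
  rw [h']
  obtain ⟨w₀, hw₀, h₀⟩ := exists_hyperplaneSection_mk_primeCycle_eq (N := n + 1) (K := K) (n := 0) hw'
  rw [ChowGroup.ofPoint, h₀]
  exact ChowGroup.degree_ofPoint_eq_one (X := projectiveSpace (n + 1) K) (hw₀.1.trans (by simp))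

/-! ### §4 The Chow-side identity `M^{n+1} · deg (c₁(𝒪_X(1))^{n+1} ∩ [X]) = [K(X) : K(ℙ^{n+1})]` -/

/-- **`M^{n+1} · deg (c₁(𝒪_X(1)) ∩ (c₁(𝒪_X(1))^n ∩ [X])) = [K(X) : K(ℙ^{n+1})]`** for a finite dominant
`ψ : X → ℙ^{n+1}` with `ψ^*H ∼ M • H_X` (`K` algebraically closed, `dim X = n + 1`): push the
`0`-cycle `(ψ^*H)^{n+1} · [X] = M^{n+1} • (c₁(𝒪_X(1))^{n+1} ∩ [X])` forward along `ψ` (the degree is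
invariant, `ChowGroup.degree_pushforward`), where it becomes `c₁(𝒪(1))^{n+1} ∩ ψ_*[X] =
[K(X) : K(ℙ^{n+1})] • (c₁(𝒪(1))^{n+1} ∩ [ℙ^{n+1}])`, of degree `[K(X) : K(ℙ^{n+1})]`.
[cite: Fulton1998, Prop. 2.3 (c) (p. 34) and Example 2.5.2 (p. 41)] -/
theorem natCast_pow_mul_degree_hyperplaneSection_iter_eq_finrank [IsAlgClosed K] {n : ℕ}
    (hdim : height (genericPoint ↥X.left) = ((0 + 1 + n : ℕ) : ℕ∞))
    (ψ : X ⟶ projectiveSpace (n + 1) K) [IsDominant ψ.left] [IsFinite ψ.left] {M : ℕ}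
    (hlin : (CartierDivisor.pullback (X := (projectiveSpace (n + 1) K).left) (hyperplane (n + 1) K)
      ψ.left).LinEquiv (M • (formDivisor ℓ₀ hℓ₀ hℓ₀0).pullbackAvoiding j.left hX₀)) :
    (M : ℤ) ^ (n + 1) *
        ChowGroup.degree X (hyperplaneSectionOn j hℓ₀ hℓ₀0 hX₀ 0
          (hyperplaneSectionOnIter j hℓ₀ hℓ₀0 hX₀ (0 + 1) n
            (ChowGroup.ofPoint (genericPoint ↥X.left) hdim))) =
      Module.finrank (projectiveSpace (n + 1) K).left.functionField (FunctionFieldOver ψ.left) := by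
  set r := Module.finrank (projectiveSpace (n + 1) K).left.functionField (FunctionFieldOver ψ.left)
    with hr
  set y := ChowGroup.ofPoint (genericPoint ↥X.left) hdim with hy
  set z := hyperplaneSectionOn j hℓ₀ hℓ₀0 hX₀ 0 (hyperplaneSectionOnIter j hℓ₀ hℓ₀0 hX₀ (0 + 1) n y)
    with hz
  have hgenP : height (genericPoint ↥(projectiveSpace (n + 1) K).left) = ((0 + 1 + n : ℕ) : ℕ∞) := by
    rw [ProjSpace.height_genericPoint_eq, show 0 + 1 + n = n + 1 by omega]
  -- `M^{n+1} • z = M • (c₁ ∩ (M^n • (c₁^n ∩ [X])))`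
  have h1 : M ^ (n + 1) • z =
      M • hyperplaneSectionOn j hℓ₀ hℓ₀0 hX₀ 0
        (M ^ n • hyperplaneSectionOnIter j hℓ₀ hℓ₀0 hX₀ (0 + 1) n y) := by
    rw [hz, map_nsmul, _root_.smul_smul, ← pow_succ']
  -- push forward along `ψ`
  have hL : ChowGroup.pushforward 0 (map_mem_ratTrivial_holds 0) ψ (M ^ (n + 1) • z) =
      r • hyperplaneSection (n + 1) K 0 (hyperplaneSectionIter (n + 1) K (0 + 1) n
        (ChowGroup.ofPoint (genericPoint ↥(projectiveSpace (n + 1) K).left) hgenP)) := by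
    rw [h1, pushforward_nsmul_hyperplaneSectionOn j hℓ₀ hℓ₀0 hX₀ ψ hlin 0,
      pushforward_pow_nsmul_hyperplaneSectionOnIter j hℓ₀ hℓ₀0 hX₀ ψ hlin (0 + 1) n, hy,
      pushforward_ofPoint_genericPoint_eq_finrank_smul ψ hdim hgenP, map_nsmul, map_nsmul]
  have h2 := ChowGroup.degree_pushforward ψ (M ^ (n + 1) • z)
  rw [hL, map_nsmul, degree_hyperplaneSection_hyperplaneSectionIter_ofPoint_genericPoint n hgenP,
    map_nsmul, nsmul_eq_mul, mul_one, nsmul_eq_mul, Nat.cast_pow] at h2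
  exact h2.symm

/-! ### §5 Projective Noether normalisation with its `h⁰`-asymptotic degree; comparing expansions -/

omit [Infinite K] in
/-- **Projective Noether normalisation with linear-equivalence control and its `h⁰`-asymptotics** (Görtz–Wedhorn I,
Thm. 13.89, the tree's `CartierDivisor.IsAmple.exists_finite_surjective_linEquiv`; and
`CartierDivisor.hasAsympDegree_pullback_hyperplane`): for an ample `D` on the integral proper `X` of
dimension `d` there are `M > 0` and a finite surjective `K`-morphism `ψ : X → ℙ^d` with `ψ^*H ∼ M • D`
and `h⁰(k ψ^*H) = [K(X) : K(ℙ^d)] k^d/d! + O(k^{d-1})`. [cite: GortzWedhorn2020, Thm. 13.89 (p. 412)] -/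
theorem exists_finite_linEquiv_nsmul_hasAsympDegree {d : ℕ} (hsd : schemeDim X.left = d)
    (D : CartierDivisor X.left) (hD : D.IsAmple) :
    ∃ (M : ℕ) (ψ : X ⟶ projectiveSpace d K) (hψ : IsDominant ψ.left), 0 < M ∧ IsFinite ψ.left ∧
      (@CartierDivisor.pullback _ _ (hyperplane d K) X.left _ ψ.left hψ).LinEquiv (M • D) ∧
      (@CartierDivisor.pullback _ _ (hyperplane d K) X.left _ ψ.left hψ).HasAsympDegree K d
        (Module.finrank (projectiveSpace d K).left.functionField (@FunctionFieldOver _ _ _ _ ψ.left hψ)) := by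
  subst hsd
  haveI : IsProper (X.left ↘ Spec (.of K)) := ‹IsProper X.hom›
  obtain ⟨n₀, hn₀⟩ := hD.exists_finite_surjective_linEquiv (K := K)
  obtain ⟨c, ψ, hψfin, hψsurj, hψover, hlin⟩ :=
    hn₀ 2 one_lt_two (n₀ + 1) (Nat.le_succ _) (Nat.succ_pos _)
  haveI := hψsurj
  haveI := hψfin
  haveI : ψ.IsOver (Spec (.of K)) := ⟨hψover⟩
  exact ⟨(n₀ + 1) * 2 ^ c, Over.homMk ψ hψover, (inferInstance : IsDominant ψ),
    Nat.mul_pos (Nat.succ_pos _) (Nat.pow_pos two_pos), hψfin, hlin,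
    hasAsympDegree_pullback_hyperplane ψ⟩

omit [Infinite K] [IsProper X.hom] in
/-- **Comparing leading coefficients: `r = δ M^d`** if `E ∼ M • D`, `h⁰(kD) = δ k^d/d! + O(k^{d-1})` and
`h⁰(kE) = r k^d/d! + O(k^{d-1})` (then `h⁰(kE) = h⁰((Mk)D)`, and the leading coefficient of an
`h⁰`-expansion is unique — the comparison of Görtz–Wedhorn II, proof of Prop. 27.186).
[cite: GortzWedhorn2023, Prop. 23.83] -/
theorem eq_mul_pow_of_hasAsympDegree_of_linEquiv_nsmul {d : ℕ} {D E : CartierDivisor X.left}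
    {M δ r : ℕ} (hM : 0 < M) (hlin : E.LinEquiv (M • D)) (hD : D.HasAsympDegree K d δ)
    (hE : E.HasAsympDegree K d r) : r = δ * M ^ d := by
  have hm : ∀ k : ℕ, (((k • E).h0 K : ℕ) : ℝ) = ((((M * k) • D).h0 K : ℕ) : ℝ) := fun k => by
    rw [(hlin.smul k).h0_eq K, CartierDivisor.smul_smul]
  have h1 := isBigO_comp_mul (u := fun m : ℕ => (((m • D).h0 K : ℕ) : ℝ)) hM hD
  unfold CartierDivisor.HasAsympDegree at hE
  have hdiff := hE.sub h1
  have key : (δ : ℝ) * (M : ℝ) ^ d = (r : ℝ) := by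
    refine eq_of_sub_mul_pow_div_isBigO (d := d) (hdiff.congr_left fun k => ?_)
    simp only [hm k]
    ring
  exact_mod_cast key.symm

/-! ### §6 The bridge `deg (c₁(𝒪_X(1))^{dim X} ∩ [X]) = asympDegree H_X` -/

omit [Infinite K] [IsProper X.hom] in
/-- Dimension bookkeeping: if the generic point of `X` has height `e` then `schemeDim X = e` (the
dimension of an irreducible scheme is the height of its generic point in the specialisation order — the
tree's `Scheme.height_genericPoint`; Hartshorne II.3 p. 86: the dimension of a scheme is that of its
space, II Ex. 2.9: unique generic points). [cite: Hartshorne1977, II Ex. 2.9 and II.3 p. 86 (definition of dimension)] -/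
theorem schemeDim_eq_of_height_genericPoint_eq {e : ℕ}
    (h : height (genericPoint ↥X.left) = (e : ℕ∞)) : schemeDim X.left = e := by
  have hk := Scheme.height_genericPoint X.left
  rw [h] at hk
  unfold schemeDim
  rw [← hk]
  rfl

omit [Infinite K] [IsProper X.hom] in
/-- **`H_X = V₊(ℓ₀)|_X` is ample** (pull-back of the ample `𝒪(1)` along the affine closed immersion
`j`; Görtz–Wedhorn I, Prop. 13.66 (2), the tree's `CartierDivisor.IsAmple.pullbackAvoiding`).
[cite: GortzWedhorn2020, Prop. 13.66 (2) (p. 402)] -/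
theorem isAmple_pullbackAvoiding_formDivisor :
    ((formDivisor ℓ₀ hℓ₀ hℓ₀0).pullbackAvoiding j.left hX₀).IsAmple :=
  CartierDivisor.IsAmple.pullbackAvoiding j.left hX₀
    ((hyperplane_linEquiv_formDivisor hℓ₀ hℓ₀0).isAmple isAmple_hyperplane)

/-- **The bridge, with the `h⁰`-side as a binder: `deg (c₁(𝒪_X(1)) ∩ (c₁(𝒪_X(1))^n ∩ [X])) = δ`
whenever `h⁰(k H_X) = δ k^{n+1}/(n+1)! + O(k^n)`** — for an integral `X ↪ ℙᴺ_K` of dimension `n + 1`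
over an algebraically closed field, `H_X = V₊(ℓ₀)|_X` its hyperplane-section divisor: Fulton's degree
`∫_X c₁(𝒪_X(1))^{n+1} ∩ [X]` (Example 2.5.2) equals the `h⁰`-asymptotic degree `(𝒪_X(1)^{n+1})`
(Görtz–Wedhorn II, Def. 23.80 / Prop. 23.83).  Proof: with a finite surjective `ψ : X → ℙ^{n+1}`,
`ψ^*H ∼ M • H_X` (Noether normalisation), `M^{n+1} · deg = [K(X) : K(ℙ^{n+1})]` by the projection
formula (`natCast_pow_mul_degree_hyperplaneSection_iter_eq_finrank`) and `[K(X) : K(ℙ^{n+1})] = δ M^{n+1}`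
by comparing `h⁰`-expansions (`eq_mul_pow_of_hasAsympDegree_of_linEquiv_nsmul`).  This is the (C4)
letter of the cell's F-9 (9a) chain, stated against
`ChowGroup.degree X (hyperplaneSectionOn j … 0 (hyperplaneSectionOnIter j … (0 + 1) n [X]))`.
[cite: Fulton1998, Example 2.5.2 (p. 41)] [cite: GortzWedhorn2023, Def. 23.80 and Prop. 23.83] -/
theorem degree_hyperplaneSection_iter_fundamental_eq_of_hasAsympDegree [IsAlgClosed K] {n : ℕ}
    (hdim : height (genericPoint ↥X.left) = ((n + 1 : ℕ) : ℕ∞)) {δ : ℕ}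
    (hδ : ((formDivisor ℓ₀ hℓ₀ hℓ₀0).pullbackAvoiding j.left hX₀).HasAsympDegree K (n + 1) δ) :
    ChowGroup.degree X (hyperplaneSectionOn j hℓ₀ hℓ₀0 hX₀ 0
      (hyperplaneSectionOnIter j hℓ₀ hℓ₀0 hX₀ (0 + 1) n
        (ChowGroup.mk X.left (0 + 1 + n) ⟨primeCycle (genericPoint ↥X.left),
          primeCycle_mem_cyclesOfDim (by rw [hdim]; push_cast; ring)⟩))) = δ := by
  have hsd : schemeDim X.left = n + 1 := schemeDim_eq_of_height_genericPoint_eq hdim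
  obtain ⟨M, ψ, hψ, hM, hfin, hlin, hE⟩ :=
    exists_finite_linEquiv_nsmul_hasAsympDegree (X := X) hsd _ (isAmple_pullbackAvoiding_formDivisor j hℓ₀ hℓ₀0 hX₀)
  haveI := hψ
  haveI := hfin
  have hC := natCast_pow_mul_degree_hyperplaneSection_iter_eq_finrank j hℓ₀ hℓ₀0 hX₀
    (hdim.trans (by rw [show 0 + 1 + n = n + 1 by omega])) ψ hlin
  have hA := eq_mul_pow_of_hasAsympDegree_of_linEquiv_nsmul (K := K) hM hlin hδ hE
  rw [hA, Nat.cast_mul, Nat.cast_pow] at hC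
  have hM' : ((M : ℤ) ^ (n + 1)) ≠ 0 := pow_ne_zero _ (by exact_mod_cast hM.ne')
  exact mul_left_cancel₀ hM' (hC.trans (mul_comm _ _))

/-- **`deg (c₁(𝒪_X(1)) ∩ (c₁(𝒪_X(1))^n ∩ [X])) = asympDegree K H_X (n + 1)`** for an integral
`X ↪ ℙᴺ_K` of dimension `n + 1` over an algebraically closed field: the Fulton degree of `X` IS the
`h⁰`-asymptotic degree of its hyperplane class (`H_X` is ample, so the asymptotic Riemann–Roch theorem
`CartierDivisor.asymptoticRiemannRoch_of_isAmple_holds` provides the expansion; then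
`degree_hyperplaneSection_iter_fundamental_eq_of_hasAsympDegree`). [cite: Fulton1998, Example 2.5.2 (p. 41)]
[cite: GortzWedhorn2023, Def. 23.80 and Prop. 23.83] -/
theorem degree_hyperplaneSection_iter_fundamental_eq_asympDegree [IsAlgClosed K] {n : ℕ}
    (hdim : height (genericPoint ↥X.left) = ((n + 1 : ℕ) : ℕ∞)) :
    ChowGroup.degree X (hyperplaneSectionOn j hℓ₀ hℓ₀0 hX₀ 0
      (hyperplaneSectionOnIter j hℓ₀ hℓ₀0 hX₀ (0 + 1) n
        (ChowGroup.mk X.left (0 + 1 + n) ⟨primeCycle (genericPoint ↥X.left),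
          primeCycle_mem_cyclesOfDim (by rw [hdim]; push_cast; ring)⟩))) =
      ((formDivisor ℓ₀ hℓ₀ hℓ₀0).pullbackAvoiding j.left hX₀).asympDegree K (n + 1) := by
  have hsd : schemeDim X.left = n + 1 := schemeDim_eq_of_height_genericPoint_eq hdim
  haveI : IsProper (X.left ↘ Spec (.of K)) := ‹IsProper X.hom›
  obtain ⟨δ, -, hδ⟩ := CartierDivisor.asymptoticRiemannRoch_of_isAmple_holds K X.left _
    (isAmple_pullbackAvoiding_formDivisor j hℓ₀ hℓ₀0 hX₀)
  rw [hsd] at hδ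
  rw [hδ.asympDegree_eq]
  exact degree_hyperplaneSection_iter_fundamental_eq_of_hasAsympDegree j hℓ₀ hℓ₀0 hX₀ hdim hδ

/-- **The degree of a projective variety is positive: `0 < deg (c₁(𝒪_X(1))^{n+1} ∩ [X])`** (the
`h⁰`-asymptotic degree of the ample `H_X` is a positive integer, Görtz–Wedhorn II, Rem. 23.82).
[cite: GortzWedhorn2023, Rem. 23.82 and Prop. 23.83] -/
theorem degree_hyperplaneSection_iter_fundamental_pos [IsAlgClosed K] {n : ℕ}
    (hdim : height (genericPoint ↥X.left) = ((n + 1 : ℕ) : ℕ∞)) :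
    0 < ChowGroup.degree X (hyperplaneSectionOn j hℓ₀ hℓ₀0 hX₀ 0
      (hyperplaneSectionOnIter j hℓ₀ hℓ₀0 hX₀ (0 + 1) n
        (ChowGroup.mk X.left (0 + 1 + n) ⟨primeCycle (genericPoint ↥X.left),
          primeCycle_mem_cyclesOfDim (by rw [hdim]; push_cast; ring)⟩))) := by
  have hsd : schemeDim X.left = n + 1 := schemeDim_eq_of_height_genericPoint_eq hdim
  haveI : IsProper (X.left ↘ Spec (.of K)) := ‹IsProper X.hom›
  obtain ⟨δ, hδ0, hδ⟩ := CartierDivisor.asymptoticRiemannRoch_of_isAmple_holds K X.left _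
    (isAmple_pullbackAvoiding_formDivisor j hℓ₀ hℓ₀0 hX₀)
  rw [hsd] at hδ
  rw [degree_hyperplaneSection_iter_fundamental_eq_of_hasAsympDegree j hℓ₀ hℓ₀0 hX₀ hdim hδ]
  exact_mod_cast hδ0

/-! ### §7 Consumer form: an exact polynomial count `h⁰(kΘ) = a k^{n+1}` (`k ≥ 1`) -/

omit [Infinite K] [IsProper X.hom] in
/-- **An exact count `h⁰(k • D) = a · k^d` for all `k ≥ 1` is an `h⁰`-asymptotic expansion with degree
`d! · a`** in the sense of Görtz–Wedhorn II, Def. 23.80 / Prop. 23.83 (`h⁰(kD) = δ k^d/d! + O(k^{d-1})`,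
here with zero error term from `k = 1` on, `δ = d! · a`). [cite: GortzWedhorn2023, Def. 23.80 and Prop. 23.83] -/
theorem hasAsympDegree_of_forall_h0_eq {d a : ℕ} {D : CartierDivisor X.left}
    (h : ∀ k : ℕ, 1 ≤ k → (k • D).h0 K = a * k ^ d) : D.HasAsympDegree K d (d.factorial * a) := by
  unfold CartierDivisor.HasAsympDegree
  refine (Asymptotics.isBigO_zero (fun k : ℕ => (k : ℝ) ^ ((d : ℤ) - 1)) atTop).congr' ?_
    Filter.EventuallyEq.rfl
  filter_upwards [Filter.eventually_ge_atTop 1] with k hk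
  rw [h k hk]
  have hd : (d.factorial : ℝ) ≠ 0 := Nat.cast_ne_zero.2 (Nat.factorial_ne_zero d)
  field_simp
  push_cast
  ring

/-- **Consumer form of the bridge: `deg (c₁(𝒪_X(1)) ∩ (c₁(𝒪_X(1))^n ∩ [X])) = (n+1)! · a`** as soon as
the hyperplane-section divisor `H_X = V₊(ℓ₀)|_X` is linearly equivalent to a divisor `Θ` with the EXACT
section count `h⁰(k • Θ) = a · k^{n+1}` for all `k ≥ 1` (`K` algebraically closed, `dim X = n + 1`) — e.g.
an abelian variety of dimension `g = n + 1` embedded by `L^Δ(λ)^{⊗3}` of type `δ`, where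
`h⁰ = (6k)^g · ∏ δᵢ` (Mumford–Fogarty–Kirwan, Prop. 6.13), has degree `g! · 6^g · ∏ δᵢ` (loc. cit.,
proof of Prop. 7.7: `r = (L'^g)`). [cite: Fulton1998, Example 2.5.2 (p. 41)]
[cite: MumfordFogartyKirwan1994, Ch. 7 §3 Prop. 7.7, proof (p. 138)] -/
theorem degree_hyperplaneSection_iter_fundamental_eq_of_forall_h0_eq [IsAlgClosed K] {n : ℕ}
    (hdim : height (genericPoint ↥X.left) = ((n + 1 : ℕ) : ℕ∞)) {Θ : CartierDivisor X.left} {a : ℕ}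
    (hΘ : ((formDivisor ℓ₀ hℓ₀ hℓ₀0).pullbackAvoiding j.left hX₀).LinEquiv Θ)
    (hh0 : ∀ k : ℕ, 1 ≤ k → (k • Θ).h0 K = a * k ^ (n + 1)) :
    ChowGroup.degree X (hyperplaneSectionOn j hℓ₀ hℓ₀0 hX₀ 0
      (hyperplaneSectionOnIter j hℓ₀ hℓ₀0 hX₀ (0 + 1) n
        (ChowGroup.mk X.left (0 + 1 + n) ⟨primeCycle (genericPoint ↥X.left),
          primeCycle_mem_cyclesOfDim (by rw [hdim]; push_cast; ring)⟩))) =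
      (((n + 1).factorial * a : ℕ) : ℤ) := by
  refine degree_hyperplaneSection_iter_fundamental_eq_of_hasAsympDegree j hℓ₀ hℓ₀0 hX₀ hdim
    (hasAsympDegree_of_forall_h0_eq (K := K) fun k hk => ?_)
  rw [(hΘ.smul k).h0_eq K]
  exact hh0 k hk

end ProjSpace

/-! ## Edition 2 (§8): non-degeneracy «`Φ(Y)` lies on no hyperplane» ([MumfordFogartyKirwan1994] Prop. 7.7, the
binder `hnd` of the (9a) count `count_lt_of_package`) for `GeneratingSections.ofCocycleSections` with linearly
independent local coefficients (`GeneratingSections.formDivisor_avoids_toProj_ofCocycleSections_genericPoint`). -/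

namespace GeneratingSections

open _root_.MvPolynomial (X C)


section Chart

variable {ι : Type} {Y : Scheme.{u}} (D : GeneratingSections ι Y) {k : Type u} [CommRing k]
  (f : Y ⟶ Spec (.of k)) (i : ι) {T : Scheme.{u}} (g : T ⟶ Y) (hg : ⊤ ≤ g ⁻¹ᵁ D.U i)

/-- **The `i`-th chart pulls `D₊(F)` back to `T_{F(s/sᵢ)}`**: for a form `F` of degree `n ≥ 1`, the
preimage of the basic open `D₊(F) ⊆ ℙ(ι)` under the chart map `T → D₊(xᵢ) ⊆ ℙ(ι)`, `x_j/x_i ↦ s_j/s_i`,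
is the non-vanishing locus of `F(s_•/s_i) ∈ Γ(T, 𝒪_T)` (Hartshorne II, proof of Thm. 7.1; the case
`F = x_j` is `chartMap_preimage_basicOpen`). [cite: Hartshorne1977, II proof of Thm. 7.1] -/
theorem chartMap_preimage_basicOpen_of_mem_grading {n : ℕ} (hn : 0 < n) {F : MvPolynomial ι k}
    (hF : F ∈ grading ι k n) :
    letI := MvPolynomial.gradedAlgebra (σ := ι) (R := k)
    D.chartMap f i g hg ⁻¹ᵁ Proj.basicOpen (grading ι k) F = T.basicOpen (D.chartFun f i g hg F) := by
  letI := MvPolynomial.gradedAlgebra (σ := ι) (R := k)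
  rw [chartMap, Scheme.Hom.comp_preimage, Scheme.Hom.comp_preimage,
    Proj.awayι_preimage_basicOpen _ (X_mem k i) zero_lt_one hF hn, SpecMap_preimage_basicOpen,
    Scheme.toSpecΓ_preimage_basicOpen]
  change T.basicOpen (D.chartRingHom f i g hg
    (HomogeneousLocalization.Away.mk _ (X_mem k i) n (F ^ 1) _)) = _
  rw [chartRingHom_awayMk, map_pow, pow_one]

/-- `chartFun` of a linear form `Σ c_j x_j` is `Σ c_j (s_j/s_i)`. [cite: Hartshorne1977, II proof of Thm. 7.1] -/
theorem chartFun_sum_smul_X [Fintype ι] (c : ι → k) :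
    D.chartFun f i g hg (∑ j, c j • X j) = ∑ j, pull (g ≫ f) (c j) * res g (D.U i) hg (D.ratio i j) := by
  rw [map_sum]
  refine Finset.sum_congr rfl fun j _ => ?_
  rw [MvPolynomial.smul_eq_C_mul, map_mul, chartFun_C, chartFun_X]

end Chart

section Nondeg

variable {K : Type u} [Field K] {d : ℕ} {Y : Scheme.{u}} [IsIntegral Y] (f : Y ⟶ Spec (.of K))
  {α : Type*} {W : α → Y.Opens} (S : CocycleSections (Fin (d + 1)) W)
  (hcov : ⨆ i, ⨆ a, Y.basicOpen (S.coeff i a) = ⊤)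

/-- A linear form is a `K`-combination of the coordinates (Mathlib `homogeneousSubmodule_one_eq_span_X`).
[folklore] -/
private theorem exists_eq_sum_smul_X {ℓ : MvPolynomial (Fin (d + 1)) K}
    (hℓ : ℓ ∈ grading (Fin (d + 1)) K 1) : ∃ c : Fin (d + 1) → K, ∑ j, c j • X j = ℓ := by
  have h : ℓ ∈ Submodule.span K (Set.range (X : Fin (d + 1) → MvPolynomial (Fin (d + 1)) K)) := by
    rw [← MvPolynomial.homogeneousSubmodule_one_eq_span_X]
    exact hℓ
  exact (Submodule.mem_span_range_iff_exists_fun K).1 h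

/-- **NON-DEGENERACY of a morphism to projective space** ([MumfordFogartyKirwan1994] Prop. 7.7, the
hypothesis «`Φ(A)` is not contained in any hyperplane»; Hartshorne II Thm. 7.1 / Ex. 7.8): let the morphism
`Y → ℙ^d_K` of an integral `K`-scheme be given by sections with local coefficients `c j a ∈ Γ(Y, W a)`
(`GeneratingSections.ofCocycleSections`).  If on ONE non-empty frame open `Y_{c i a} ⊆ W a` the coefficients
are `K`-linearly independent — `Σ_j r_j c j a = 0` on `W a` only for `r = 0` — then for EVERY non-zero linear
form `ℓ` the hyperplane `V₊(ℓ)` misses the image of the generic point of `Y`, i.e. the divisor `V₊(ℓ)`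
AVOIDS it and the hyperplane section `V₊(ℓ)|_Y` is an honest pull-back.  Proof: on `Y_{c i a}` the chart
`x_j/x_i ↦ c j a / c i a` pulls `D₊(ℓ)` back to the non-vanishing locus of `Σ_j ℓ_j c j a / c i a`
(`chartMap_preimage_basicOpen_of_mem_grading`, `ofCocycleSections_ratio_res_mul`), which is non-zero on the
integral `Y` (independence), hence non-vanishing at the generic point.
[cite: MumfordFogartyKirwan1994, Ch. 7 §3 Prop. 7.7 (p. 138)] [cite: Hartshorne1977, II Thm. 7.1 (p. 150)] -/
theorem formDivisor_avoids_toProj_ofCocycleSections_genericPoint (i : Fin (d + 1)) (a : α)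
    (hne : ∃ y, y ∈ Y.basicOpen (S.coeff i a))
    (hind : ∀ r : Fin (d + 1) → K,
      (∑ j, Y.presheaf.map (homOfLE le_top).op (pull f (r j)) * S.coeff j a) = 0 → r = 0)
    {ℓ : MvPolynomial (Fin (d + 1)) K} (hℓ : ℓ ∈ grading (Fin (d + 1)) K 1) (hℓ0 : ℓ ≠ 0) :
    (ProjSpace.formDivisor ℓ hℓ hℓ0).Avoids
      (((ofCocycleSections W S hcov).toProj f).base (genericPoint Y)) := by
  classical
  letI := MvPolynomial.gradedAlgebra (σ := Fin (d + 1)) (R := K)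
  set G := ofCocycleSections W S hcov with hG
  obtain ⟨c, hc⟩ := exists_eq_sum_smul_X hℓ
  -- the frame open `V = Y_{c i a}` contains the generic point and lies in `U i` and in `W a`
  set V : Y.Opens := Y.basicOpen (S.coeff i a) with hV
  obtain ⟨y, hy⟩ := hne
  have hηV : genericPoint Y ∈ V := ((genericPoint_spec Y).mem_open_set_iff V.isOpen).2 ⟨y, Set.mem_univ _, hy⟩
  have hVU : V ≤ G.U i := basicOpen_le_ofCocycleSections_U W S hcov i a
  have hVW : V ≤ W a := Y.basicOpen_le (S.coeff i a)
  have hg : ⊤ ≤ V.ι ⁻¹ᵁ G.U i := (top_le_ι_preimage V).trans (Scheme.Hom.preimage_mono V.ι hVU)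
  have hgW : ⊤ ≤ V.ι ⁻¹ᵁ W a := (top_le_ι_preimage V).trans (Scheme.Hom.preimage_mono V.ι hVW)
  -- `Avoids` says: the image point lies in `D₊(ℓ)`
  rw [ProjSpace.formDivisor_avoids_iff hℓ hℓ0 zero_lt_one, ← ProjectiveSpectrum.mem_basicOpen]
  -- compute through the chart on `V`
  have hη : (G.toProj f).base (genericPoint Y) =
      (G.chartMap f i V.ι hg).base (⟨genericPoint Y, hηV⟩ : V) := by
    rw [← G.comp_toProj f V.ι hg, Scheme.Hom.comp_base, TopCat.coe_comp, Function.comp_apply]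
    rfl
  change (G.toProj f).base (genericPoint Y) ∈ (Proj.basicOpen (grading (Fin (d + 1)) K) ℓ : Set _)
  rw [hη]
  change (⟨genericPoint Y, hηV⟩ : V) ∈ G.chartMap f i V.ι hg ⁻¹ᵁ Proj.basicOpen (grading (Fin (d + 1)) K) ℓ
  rw [G.chartMap_preimage_basicOpen_of_mem_grading f i V.ι hg zero_lt_one hℓ, ← hc,
    G.chartFun_sum_smul_X f i V.ι hg c]
  -- the unit `u = c i a |_V` and the key identity `u · Σ c_j (s_j/s_i) = (Σ c_j c j a)|_V`
  set u : Γ(↑V, ⊤) := res V.ι (W a) hgW (S.coeff i a) with hu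
  have hunit : IsUnit u := by
    have h1 : IsUnit (Y.presheaf.map (homOfLE hVW).op (S.coeff i a)) :=
      RingedSpace.isUnit_res_basicOpen _ (S.coeff i a)
    have h2 := h1.map (res V.ι V (top_le_ι_preimage V))
    rwa [res_map V.ι (W a) hgW (top_le_ι_preimage V) hVW] at h2
  have hkey : ∀ j, res V.ι (G.U i) hg (G.ratio i j) * u = res V.ι (W a) hgW (S.coeff j a) := fun j => by
    have h := congrArg (res V.ι V (top_le_ι_preimage V)) (ofCocycleSections_ratio_res_mul W S hcov i j a)
    rw [map_mul, res_map V.ι (G.U i) hg (top_le_ι_preimage V) hVU,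
      res_map V.ι (W a) hgW (top_le_ι_preimage V) hVW,
      res_map V.ι (W a) hgW (top_le_ι_preimage V) hVW] at h
    exact h
  -- the section `Σ_j c_j · c j a ∈ Γ(Y, W a)` and its restriction to `V`
  set sY : Γ(Y, W a) := ∑ j, Y.presheaf.map (homOfLE le_top).op (pull f (c j)) * S.coeff j a with hsY
  have hprod : (∑ j, pull (V.ι ≫ f) (c j) * res V.ι (G.U i) hg (G.ratio i j)) * u =
      res V.ι (W a) hgW sY := by
    rw [hsY, map_sum, Finset.sum_mul]
    refine Finset.sum_congr rfl fun j _ => ?_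
    rw [map_mul, res_map_pull, mul_assoc, hkey j]
  have hsY0 : sY ≠ 0 := by
    intro h0
    have hc0 : c = 0 := hind c h0
    apply hℓ0
    rw [← hc, hc0]
    simp
  -- `V_{Σ c_j s_j/s_i} = V ∩ Y_{sY}`, which contains the generic point
  have hbo : (↑V : Scheme.{u}).basicOpen (∑ j, pull (V.ι ≫ f) (c j) * res V.ι (G.U i) hg (G.ratio i j)) =
      V.ι ⁻¹ᵁ Y.basicOpen sY := by
    rw [← basicOpen_res V.ι (W a) hgW sY, ← hprod, Scheme.basicOpen_mul,
      (↑V : Scheme.{u}).basicOpen_of_isUnit hunit, inf_top_eq]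
  rw [hbo]
  change genericPoint Y ∈ Y.basicOpen sY
  have hne' : Y.basicOpen sY ≠ ⊥ := fun h => hsY0 ((basicOpen_eq_bot_iff sY).1 h)
  obtain ⟨z, hz⟩ : ∃ z, z ∈ Y.basicOpen sY := by
    by_contra hz
    exact hne' (le_bot_iff.1 fun z hz' => (hz ⟨z, hz'⟩).elim)
  exact ((genericPoint_spec Y).mem_open_set_iff (Y.basicOpen sY).isOpen).2 ⟨z, Set.mem_univ _, hz⟩

end Nondeg

end GeneratingSections

end Literature.AlgebraicGeometry.Motives

end
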